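import Mathlib
import HarnessLib
import Summits.NavierStokesRegularity.NavierStokesRegularity.Theorems.PoloidalWindowDoorLrcModEntireAxisKinematics4

/-!
# Route `PoloidalWindowDoor`, item `LrcModEntire` (stmt-NavierStokesRegularity-20428) — AXIS KINEMATICS VII: the angular-harmonics lemma
# PER PLANE (hypotheses only on `O ∩ {y₂ = z₀}`), as needed when the coefficient vectors `a = c′(z)`, `w′ = Jc″(z)` vary with the height

Cell ns-regularity-ideate, seat ns-poloidal-K2-p3 gen 5 (LEAD of item 20428; file landed `--supports stmt-NavierStokesRegularity-20428` as a
helper).  Step IV′ of the AXIS-NOTE successor plan: in the identity (★) of `…AxisKinematics3` the vectors `a = c′(y₂)`, `w′ = Jc″(y₂)` depend on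
the height, so `…AxisKinematics4.angular_harmonics` (constant vectors on an `ℝ³`-open set) must be applied plane by plane.  Since the rotation
generator `L = D(·)[J(· − c)]` is HORIZONTAL, every step of «apply `L` twice» only needs the data on `O ∩ {y₂ = z₀}`:

* `fderiv_apply_eq_of_eqOn_plane_nhds` — local plane lemma: two functions differentiable at `x` that agree on `{y₂ = x₂}` NEAR `x` have equal
  horizontal derivatives at `x` (cf. `…TimeHeightShearLinearSlice.fderiv_apply_eq_of_eqOn_plane`, which needs agreement on the whole plane);
* `angular_harmonics_plane` — **`αU_wU_a + βU_w + γU_{w′} = 0` on `O ∩ {y₂ = z₀}`, with `α, β, γ` differentiable and `L`-annihilated there,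
  `w = Ja` ⇒ `αU_wU_a = 0` on `O ∩ {y₂ = z₀}`.**

WHAT THIS IS NOT: not a claim about Navier–Stokes regularity and not the axis lemma — planar calculus (bears_on LADDER-NS N0 via item 20428).
-/

noncomputable section

-- the summit and its single sub-problem share the name (CONVENTIONS §1), as in every Theorems file
set_option linter.dupNamespace false

namespace Summit.NavierStokesRegularity.NavierStokesRegularity.Theorems.PoloidalWindowDoorLrcModEntireAxisKinematics7

open Set Function Filter Topology Metric
open scoped RealInnerProductSpace InnerProductSpace
open Literature.Analysis Literature.Analysis.FluidPDE
open Summit.NavierStokesRegularity.NavierStokesRegularity.Theorems.PoloidalWindowDoorLrcModEntireAxisKinematics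
open Summit.NavierStokesRegularity.NavierStokesRegularity.Theorems.PoloidalWindowDoorLrcModEntireAxisKinematics4

/-! ### Local plane lemma -/

/-- **Horizontal derivatives see only the plane, locally.**  If `g₁, g₂ : ℝ³ → ℝ` are differentiable at `x` and agree at all points NEAR `x`
of the horizontal plane `{y | y₂ = x₂}`, then `D g₁(x) e_b = D g₂(x) e_b` for `b ≠ 2`. -/
theorem fderiv_apply_eq_of_eqOn_plane_nhds {g₁ g₂ : EuclideanSpace ℝ (Fin 3) → ℝ} {x : EuclideanSpace ℝ (Fin 3)}
    (h₁ : DifferentiableAt ℝ g₁ x) (h₂ : DifferentiableAt ℝ g₂ x)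
    (heq : ∀ᶠ y in 𝓝 x, y 2 = x 2 → g₁ y = g₂ y) {b : Fin 3} (hb : b ≠ 2) :
    fderiv ℝ g₁ x (EuclideanSpace.single b 1) = fderiv ℝ g₂ x (EuclideanSpace.single b 1) := by
  set e : EuclideanSpace ℝ (Fin 3) := EuclideanSpace.single b 1 with he
  have hγ : HasDerivAt (fun s : ℝ => x + s • e) e 0 := by
    simpa using ((hasDerivAt_id (0 : ℝ)).smul_const e).const_add x
  have hd₁ : HasDerivAt (fun s : ℝ => g₁ (x + s • e)) (fderiv ℝ g₁ x e) 0 :=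
    h₁.hasFDerivAt.comp_hasDerivAt_of_eq (0 : ℝ) hγ (by simp)
  have hd₂ : HasDerivAt (fun s : ℝ => g₂ (x + s • e)) (fderiv ℝ g₂ x e) 0 :=
    h₂.hasFDerivAt.comp_hasDerivAt_of_eq (0 : ℝ) hγ (by simp)
  -- the line stays in the plane and, for small `s`, near `x`
  have hcont : Tendsto (fun s : ℝ => x + s • e) (𝓝 0) (𝓝 x) := by
    have : Continuous (fun s : ℝ => x + s • e) := by fun_prop
    simpa using this.tendsto 0
  have he2 : e 2 = 0 := by simp [he, hb.symm]
  have hline : (fun s : ℝ => g₁ (x + s • e)) =ᶠ[𝓝 0] fun s : ℝ => g₂ (x + s • e) := by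
    filter_upwards [hcont.eventually heq] with s hs
    exact hs (by simp [he2])
  exact (hd₁.congr_of_eventuallyEq hline.symm).unique hd₂ |> fun h => by
    have := hd₂.unique (hd₁.congr_of_eventuallyEq hline.symm)
    exact this.symm

/-! ### The angular-harmonics lemma on one plane -/

/-- **«Apply `L` twice», per plane.**  Let `O ⊆ ℝ³` be open, `z₀` a height, `c a w′ ∈ ℝ³` (only horizontal parts enter), `w = Ja`.  Suppose
`α β γ` are differentiable and `L`-annihilated at every point of `O ∩ {y₂ = z₀}` (`L = D(·)[J(· − c)]`), and
`α U_wU_a + β U_w + γ U_{w′} = 0` on `O ∩ {y₂ = z₀}` (`U_p(y) = (y₀−c₀)p₀ + (y₁−c₁)p₁`).  Then `α U_wU_a = 0` on `O ∩ {y₂ = z₀}`. -/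
theorem angular_harmonics_plane {α β γ : EuclideanSpace ℝ (Fin 3) → ℝ} {c a w' : EuclideanSpace ℝ (Fin 3)}
    {O : Set (EuclideanSpace ℝ (Fin 3))} (hO : IsOpen O) {z₀ : ℝ}
    (hα : ∀ y ∈ O, y 2 = z₀ → DifferentiableAt ℝ α y) (hβ : ∀ y ∈ O, y 2 = z₀ → DifferentiableAt ℝ β y)
    (hγ : ∀ y ∈ O, y 2 = z₀ → DifferentiableAt ℝ γ y)
    (hLα : ∀ y ∈ O, y 2 = z₀ → fderiv ℝ α y (rotGen (y - c)) = 0)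
    (hLβ : ∀ y ∈ O, y 2 = z₀ → fderiv ℝ β y (rotGen (y - c)) = 0)
    (hLγ : ∀ y ∈ O, y 2 = z₀ → fderiv ℝ γ y (rotGen (y - c)) = 0)
    (hΦ : ∀ y ∈ O, y 2 = z₀ →
      α y * (((y 0 - c 0) * (-a 1) + (y 1 - c 1) * a 0) * ((y 0 - c 0) * a 0 + (y 1 - c 1) * a 1)) +
        β y * ((y 0 - c 0) * (-a 1) + (y 1 - c 1) * a 0) +
        γ y * ((y 0 - c 0) * w' 0 + (y 1 - c 1) * w' 1) = 0)
    {y : EuclideanSpace ℝ (Fin 3)} (hy : y ∈ O) (hyz : y 2 = z₀) :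
    α y * (((y 0 - c 0) * (-a 1) + (y 1 - c 1) * a 0) * ((y 0 - c 0) * a 0 + (y 1 - c 1) * a 1)) = 0 := by
  -- the affine functions
  set Uw : EuclideanSpace ℝ (Fin 3) → ℝ := fun y' => (y' 0 - c 0) * (-a 1) + (y' 1 - c 1) * a 0 with hUw
  set Ua : EuclideanSpace ℝ (Fin 3) → ℝ := fun y' => (y' 0 - c 0) * a 0 + (y' 1 - c 1) * a 1 with hUa
  set Uw' : EuclideanSpace ℝ (Fin 3) → ℝ := fun y' => (y' 0 - c 0) * w' 0 + (y' 1 - c 1) * w' 1 with hUw'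
  -- `J w'` as a vector
  set jw' : EuclideanSpace ℝ (Fin 3) := rotGen w' with hjw'
  set Ujw' : EuclideanSpace ℝ (Fin 3) → ℝ := fun y' => (y' 0 - c 0) * jw' 0 + (y' 1 - c 1) * jw' 1 with hUjw'
  -- `w` as a vector `(−a₁, a₀, a₂')`: we only use its first two coordinates through `Uw`
  set w : EuclideanSpace ℝ (Fin 3) := rotGen a with hw
  have hw0 : w 0 = -a 1 := rfl
  have hw1 : w 1 = a 0 := rfl
  have hUw_eq : Uw = fun y' => (y' 0 - c 0) * w 0 + (y' 1 - c 1) * w 1 := by rw [hw0, hw1]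
  -- `L` of the affine functions (pointwise, everywhere)
  have LUa : ∀ y', fderiv ℝ Ua y' (rotGen (y' - c)) = -Uw y' := by
    intro y'; rw [hUa, fderiv_hdot_rotGen]; simp only [hUw]; ring
  have LUw : ∀ y', fderiv ℝ Uw y' (rotGen (y' - c)) = Ua y' := by
    intro y'; rw [hUw_eq, fderiv_hdot_rotGen, hw0, hw1]; simp only [hUa]; ring
  have LUw' : ∀ y', fderiv ℝ Uw' y' (rotGen (y' - c)) = -Ujw' y' := by
    intro y'; rw [hUw', fderiv_hdot_rotGen]; simp only [hUjw', hjw', rotGen_apply_zero, rotGen_apply_one]; ring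
  have LUjw' : ∀ y', fderiv ℝ Ujw' y' (rotGen (y' - c)) = Uw' y' := by
    intro y'; rw [hUjw', fderiv_hdot_rotGen]; simp only [hUw', hjw', rotGen_apply_zero, rotGen_apply_one]; ring
  have dUa : ∀ y', DifferentiableAt ℝ Ua y' := fun y' => differentiableAt_hdot c a y'
  have dUw : ∀ y', DifferentiableAt ℝ Uw y' := fun y' => by rw [hUw_eq]; exact differentiableAt_hdot c w y'
  have dUw' : ∀ y', DifferentiableAt ℝ Uw' y' := fun y' => differentiableAt_hdot c w' y'
  have dUjw' : ∀ y', DifferentiableAt ℝ Ujw' y' := fun y' => differentiableAt_hdot c jw' y'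
  -- Φ, Φ₁ := LΦ, Φ₂ := LΦ₁
  set Φ : EuclideanSpace ℝ (Fin 3) → ℝ := fun y' => α y' * (Uw y' * Ua y') + β y' * Uw y' + γ y' * Uw' y' with hΦdef
  set Φ₁ : EuclideanSpace ℝ (Fin 3) → ℝ := fun y' => α y' * (Ua y' * Ua y' - Uw y' * Uw y') + β y' * Ua y' - γ y' * Ujw' y'
    with hΦ₁def
  set Φ₂ : EuclideanSpace ℝ (Fin 3) → ℝ := fun y' => -4 * (α y' * (Uw y' * Ua y')) - β y' * Uw y' - γ y' * Uw' y' with hΦ₂def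
  have hΦ0 : ∀ y' ∈ O, y' 2 = z₀ → Φ y' = 0 := fun y' hy' hz' => hΦ y' hy' hz'
  -- L of a function vanishing on `O ∩ {y₂ = z₀}` vanishes there (the generator is horizontal, tangent to the plane)
  have Lzero : ∀ {F : EuclideanSpace ℝ (Fin 3) → ℝ}, (∀ y' ∈ O, y' 2 = z₀ → F y' = 0) →
      ∀ y' ∈ O, y' 2 = z₀ → DifferentiableAt ℝ F y' → fderiv ℝ F y' (rotGen (y' - c)) = 0 := by
    intro F hF y' hy' hz' hFd
    have hev : ∀ᶠ y'' in 𝓝 y', y'' 2 = y' 2 → F y'' = (fun _ => (0 : ℝ)) y'' :=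
      Filter.eventually_of_mem (hO.mem_nhds hy') fun y'' hy'' h2 => hF y'' hy'' (h2.trans hz')
    have h0 := fderiv_apply_eq_of_eqOn_plane_nhds hFd (differentiableAt_const _) hev (b := 0) (by decide)
    have h1 := fderiv_apply_eq_of_eqOn_plane_nhds hFd (differentiableAt_const _) hev (b := 1) (by decide)
    rw [fderiv_fun_const] at h0 h1
    rw [fderiv_rotGen_sub_eq, h0, h1]
    simp
  -- LΦ = Φ₁ on O
  have hLΦ : ∀ y' ∈ O, y' 2 = z₀ → fderiv ℝ Φ y' (rotGen (y' - c)) = Φ₁ y' := by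
    intro y' hy' hz'
    have dα := hα y' hy' hz'; have dβ := hβ y' hy' hz'; have dγ := hγ y' hy' hz'
    have hD : HasFDerivAt Φ
        (α y' • (Uw y' • fderiv ℝ Ua y' + Ua y' • fderiv ℝ Uw y') + (Uw y' * Ua y') • fderiv ℝ α y' +
          (β y' • fderiv ℝ Uw y' + Uw y' • fderiv ℝ β y') +
          (γ y' • fderiv ℝ Uw' y' + Uw' y' • fderiv ℝ γ y')) y' := by
      rw [hΦdef]
      exact ((dα.hasFDerivAt.mul ((dUw y').hasFDerivAt.mul (dUa y').hasFDerivAt)).add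
        (dβ.hasFDerivAt.mul (dUw y').hasFDerivAt)).add (dγ.hasFDerivAt.mul (dUw' y').hasFDerivAt)
    rw [hD.fderiv]
    simp only [add_apply, smul_apply, smul_eq_mul, hLα y' hy' hz', hLβ y' hy' hz', hLγ y' hy' hz', LUa, LUw, LUw']
    simp only [hΦ₁def]
    ring
  have hΦd : ∀ y' ∈ O, y' 2 = z₀ → DifferentiableAt ℝ Φ y' := by
    intro y' hy' hz'
    have dα := hα y' hy' hz'; have dβ := hβ y' hy' hz'; have dγ := hγ y' hy' hz'
    rw [hΦdef]
    exact ((dα.mul ((dUw y').mul (dUa y'))).add (dβ.mul (dUw y'))).add (dγ.mul (dUw' y'))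
  have hΦ₁0 : ∀ y' ∈ O, y' 2 = z₀ → Φ₁ y' = 0 := fun y' hy' hz' => by
    rw [← hLΦ y' hy' hz']; exact Lzero hΦ0 y' hy' hz' (hΦd y' hy' hz')
  -- LΦ₁ = Φ₂ on O
  have hLΦ₁ : ∀ y' ∈ O, y' 2 = z₀ → fderiv ℝ Φ₁ y' (rotGen (y' - c)) = Φ₂ y' := by
    intro y' hy' hz'
    have dα := hα y' hy' hz'; have dβ := hβ y' hy' hz'; have dγ := hγ y' hy' hz'
    have hD : HasFDerivAt Φ₁
        (α y' • ((Ua y' • fderiv ℝ Ua y' + Ua y' • fderiv ℝ Ua y') - (Uw y' • fderiv ℝ Uw y' + Uw y' • fderiv ℝ Uw y')) +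
            (Ua y' * Ua y' - Uw y' * Uw y') • fderiv ℝ α y' +
          (β y' • fderiv ℝ Ua y' + Ua y' • fderiv ℝ β y') -
          (γ y' • fderiv ℝ Ujw' y' + Ujw' y' • fderiv ℝ γ y')) y' := by
      rw [hΦ₁def]
      exact ((dα.hasFDerivAt.mul (((dUa y').hasFDerivAt.mul (dUa y').hasFDerivAt).sub
        ((dUw y').hasFDerivAt.mul (dUw y').hasFDerivAt))).add
        (dβ.hasFDerivAt.mul (dUa y').hasFDerivAt)).sub (dγ.hasFDerivAt.mul (dUjw' y').hasFDerivAt)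
    rw [hD.fderiv]
    simp only [add_apply, sub_apply, smul_apply, smul_eq_mul, hLα y' hy' hz', hLβ y' hy' hz', hLγ y' hy' hz', LUa, LUw, LUjw']
    simp only [hΦ₂def]
    ring
  have hΦ₁d : DifferentiableAt ℝ Φ₁ y := by
    have dα := hα y hy hyz; have dβ := hβ y hy hyz; have dγ := hγ y hy hyz
    rw [hΦ₁def]
    exact ((dα.mul (((dUa y).mul (dUa y)).sub ((dUw y).mul (dUw y)))).add (dβ.mul (dUa y))).sub (dγ.mul (dUjw' y))
  have hΦ₂0 : Φ₂ y = 0 := by rw [← hLΦ₁ y hy hyz]; exact Lzero hΦ₁0 y hy hyz hΦ₁d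
  -- `Φ + Φ₂ = −3 α U_w U_a`
  have hsum : Φ y + Φ₂ y = -3 * (α y * (Uw y * Ua y)) := by
    simp only [hΦdef, hΦ₂def]; ring
  rw [hΦ0 y hy hyz, hΦ₂0, zero_add] at hsum
  have h3 : α y * (Uw y * Ua y) = 0 := by linarith
  simpa [hUw, hUa] using h3

end Summit.NavierStokesRegularity.NavierStokesRegularity.Theorems.PoloidalWindowDoorLrcModEntireAxisKinematics7

end
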